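import Summits.BirchSwinnertonDyer.BirchSwinnertonDyer.Theorems.SmallImageMuTransferMuTransferX9TameClass
import Summits.BirchSwinnertonDyer.BirchSwinnertonDyer.Theorems.SmallImageMuTransferMuTransferX9EulerFactorModP
import Summits.BirchSwinnertonDyer.BirchSwinnertonDyer.Theorems.SmallImageMuTransferMuTransferX9TorsionUnramifiedOutside
import HarnessLib

/-!
# K6 crux `MuTransferX9` (stmt-BirchSwinnertonDyer-19276), skeleton v6 stub `stub_stepsTwoFourOdd`,
# input «G3a», file 4: the genuine tame class AT AN `E`-SPLIT FROBENIUS, packaged in the input shape of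
# the Kolyvagin-cocycle files — a cocycle `y'` on `Gal(ℚ̄/ℚ(μ_ℓ))` in `𝒯_{pⁿ}` with (I1) integrality
# (p458422's `hyI`) and (I2/I3) the norm relation `cor [y'] = [ψ']`, `ψ'(g) = S^{2p^m}·V·φ(g)`,
# `V` a unit commuting with `S`, for every cocycle `φ` of `𝐳̄₁ = (I.redTower s)_{pⁿ}`

Cell `bsd-smallim`, seat `bsd-smallim-koly` (gen 9).  THEOREMS ONLY (no definition, no named fact, no
`sorry`).  HONEST FRAMING: helper toward the open stub `stub_stepsTwoFourOdd` of skeleton v6/v6d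
(`a90a661b046bb403` / `100eb8c6a7ccf73b`) of the crux `MuTransferX9`; closes nothing.  This is the
specialisation of file 3 (`TameClass.exists_tameClass_of_isEulerSystemClass`, p468725) at an `E`-split
arithmetic Frobenius `Fr` of depth `m` (`ρ̄(Fr) = 1`, `Fr ∈ Γ_m ∖ Γ_{m+1}`), using lur-a's
`EulerFactorModP.map_toZMod_rubinEulerFactor_eq_of_galoisRepTorsion_eq_one` (`P̄ = (1 − X)²`, from
`a_q ≡ 2`, `q ≡ 1 (mod p)`) and `EulerFactorModP.exists_aeval_unipotentPow_eq_shiftEnd_pow_mul_unit`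
(`(1 − (1+S)^{p^m u})² = S^{2p^m}·V`, koly (F5) squared), in the literal INPUT shapes of x10 g39's
`exists_kolyvaginCocycle_value` / k6-g3 p458422 `exists_kolyvaginCocycle_meetingPoint` (cocycle `y'`,
`hyI'` keyed on `(p : 𝓞 ℚ) ∉ w.asIdeal`, `cores _ N (isOpen_rootsOfUnityFixer ℚ ℓ) [y'] = [ψ']`).

* `primesEquiv_ne_of_natCast_not_mem` — `(p : 𝓞 ℚ) ∉ w ⟹ ℓ_w ≠ p` (the key change between Kato's
  `integralH1` and p458422's `hyI`).
* **`exists_tameCocycle_split`** — for `IsEulerSystemClass W p κ γ I s` (`W` globally minimal): a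
  finite `S₀` (Euler-system bad set, `2`, `p`, bad reduction) such that for `q ∉ S₀`, `𝔓 ∣ q`, an
  arithmetic Frobenius `Fr` at `𝔓` with `ρ̄(Fr) = 1`, `Fr ∈ Γ_m ∖ Γ_{m+1}`, and any layer `n`:
  `∃ y' V, hyI' ∧ IsUnit V ∧ Commute S V ∧ ∀ φ, [φ] = (I.redTower s)_{pⁿ} → ∃ ψ', (∀ g, ψ'(g) =
  (S^{2p^m}·V)(φ(g))) ∧ cor_N [y'] = [ψ']` — MU-TRANSFER-PROOF §3 INPUT "`cor_{K/ℚ} 𝐳̄_q = P·𝐳̄_1`,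
  `P = u_P·T^{2e}`" on the genuine objects.

References: K. Kato, Astérisque 295 (2004) (8.1.3), (13.1.1), Ex. 13.3 [Kato2004Asterisque]; K. Rubin,
*Euler Systems* (2000) §4.4 [Rubin2000]; L. Washington, *Introduction to Cyclotomic Fields* §13.1–13.2
[Washington1997]; HOME/koly/MU-TRANSFER-PROOF.md (F5), §3.
-/

-- the summit and its single problem are both named `BirchSwinnertonDyer` (registry layout D-0017)
set_option linter.dupNamespace false
set_option autoImplicit false

noncomputable section

open CategoryTheory Function Finset Polynomial
open scoped NumberField Pointwise
open Field IsDedekindDomain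
open Literature.NumberTheory.GaloisRepresentations
open Literature.NumberTheory.EllipticCurves
open Literature.NumberTheory.EllipticCurves.ZpExtension
open Literature.NumberTheory.EllipticCurves.Kato2004
open Literature.NumberTheory.EllipticCurves.Kato2004.EulerSystemValues
open Rat.HeightOneSpectrum
open Summit.BirchSwinnertonDyer.Rank1Residual.GaloisImage

namespace Summit.BirchSwinnertonDyer.BirchSwinnertonDyer.Rank1Residual.TameClass

/-- **`(p : 𝓞 ℚ) ∉ w ⟹ ℓ_w ≠ p`** for the rational prime `ℓ_w` of the place `w` (`ℓ_w ∈ w`).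
[cite: Washington1997, §13.1–§13.2] -/
theorem primesEquiv_ne_of_natCast_not_mem {p : ℕ} {w : HeightOneSpectrum (𝓞 ℚ)}
    (hw : (p : 𝓞 ℚ) ∉ w.asIdeal) : ((primesEquiv w : Nat.Primes) : ℕ) ≠ p := by
  intro h
  apply hw
  rw [Rat.natCast_mem_asIdeal_iff, ← h]
  exact dvd_rfl

variable (W : WeierstrassCurve ℚ) [W.IsElliptic] [W.IsGloballyMinimal] (p : ℕ) [Fact p.Prime]
  [ContinuousSMul ℤ_[p] (W.tateModule p)]
  [Module.Free ℤ_[p] (W.tateModule p)] [Module.Finite ℤ_[p] (W.tateModule p)]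
  (κ : ZpExtension ℚ p) (γ : absoluteGaloisGroup ℚ) (I : IwasawaH1Data W p κ γ)

/-- **The genuine tame class at an `E`-split Frobenius, in the input shape of the Kolyvagin-cocycle
files.**  For a genuine Λ-adic Euler-system class `s` there is a finite set `S₀` of places such that
for every `q ∉ S₀` (prime `ℓ`), every `𝔓 ∣ q`, every arithmetic Frobenius `Fr` at `𝔓` which is
`E`-SPLIT (`ρ̄_{E,p}(Fr) = 1`) of DEPTH `m` (`Fr ∈ Γ_m`, `Fr ∉ Γ_{m+1}`), and every layer `n`, there
are a cocycle `y'` on `N = Gal(ℚ̄/ℚ(μ_ℓ))` with values in `𝒯_{pⁿ} = E[p] ⊗ 𝔽_p[T]/(T^{pⁿ})(χ_κ)` and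
a unit `V` of `𝒯_{pⁿ}` commuting with the shift `S` such that: (I1) `[y']` vanishes on `N ∩ I_𝔓'`
for every prime `𝔓'` over every `w ∤ p` (p458422's `hyI`); (I2/I3) for every cocycle `φ` of
`𝐳̄₁ = (I.redTower s)_{pⁿ}` there is a cocycle `ψ'` with `ψ'(g) = (S^{2p^m}·V)(φ(g))` and
`cor_N^{Γ_ℚ} [y'] = [ψ']` — Kato's `cor 𝐳̄_q = P_q(Fr_q⁻¹)·𝐳̄₁` with `P_q ≡ (1 − X)² (mod p)`
(`a_q ≡ 2`, `q ≡ 1`) and `(1 − (1+T)^{κ̄(Fr)})² = T^{2p^m}·unit`.  In particular `[ψ']` dies under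
truncation to any level `J ≤ 2p^m` (the `h𝒩` of the meeting point) and, at level `pⁿ ≥ 3p^m`, `ψ'`
is the norm-witness input of the value computation (`rho_sub_eq_of_norm_witness`).
[cite: Kato2004Asterisque, (8.1.3), §13.1 (13.1.1) and Ex. 13.3 (pp. 224–225)]
[cite: Rubin2000, Def. 2.1.1 and Lemma 4.4.2] [cite: Washington1997, §13.1–§13.2] -/
theorem exists_tameCocycle_split {s : I.H} (hES : IsEulerSystemClass W p κ γ I s) :
    ∃ S₀ : Set (HeightOneSpectrum (𝓞 ℚ)), S₀.Finite ∧
      ∀ (q : HeightOneSpectrum (𝓞 ℚ)), q ∉ S₀ →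
      ∀ {𝔓 : Ideal (absIntegers (𝓞 ℚ) ℚ)}, 𝔓 ∈ q.primesAbove →
      ∀ {Fr : absoluteGaloisGroup ℚ}, IsArithFrobAt (𝓞 ℚ) Fr 𝔓 →
        WeierstrassCurve.galoisRepTorsion W p Fr = 1 →
      ∀ {m : ℕ}, Fr ∈ κ.layerSubgroup m → Fr ∉ κ.layerSubgroup (m + 1) →
      ∀ (n : ℕ) [NeZero ((primesEquiv q : Nat.Primes) : ℕ)]
        [Fintype (absoluteGaloisGroup ℚ ⧸ rootsOfUnityFixer ℚ ((primesEquiv q : Nat.Primes) : ℕ))],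
      ∃ (y' : contOneCocycles (subgroupRep (κ.twistModP (W.torsionGaloisModule (p : ℤ))
            IwasawaH1Data.torsion_nsmul_eq_zero (p ^ n)).toTopRep
            (rootsOfUnityFixer ℚ ((primesEquiv q : Nat.Primes) : ℕ))))
        (V : Module.End ℤ (Fin (p ^ n) → WeierstrassCurve.geomTorsion W (p : ℤ))),
        (∀ w : HeightOneSpectrum (𝓞 ℚ), (p : 𝓞 ℚ) ∉ w.asIdeal → ∀ 𝔓' ∈ w.primesAbove,
          resLe (κ.twistModP (W.torsionGaloisModule (p : ℤ)) IwasawaH1Data.torsion_nsmul_eq_zero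
              (p ^ n)).toTopRep
            (inf_le_left : rootsOfUnityFixer ℚ ((primesEquiv q : Nat.Primes) : ℕ) ⊓
              𝔓'.inertia (absoluteGaloisGroup ℚ) ≤ _) 1 (oneCocycleClass _ y') = 0) ∧
        IsUnit V ∧ Commute (shiftEnd (WeierstrassCurve.geomTorsion W (p : ℤ)) (p ^ n)) V ∧
        ∀ φ : contOneCocycles (κ.twistModP (W.torsionGaloisModule (p : ℤ))
            IwasawaH1Data.torsion_nsmul_eq_zero (p ^ n)).toTopRep,
          oneCocycleClass _ φ = (I.redTower s : ∀ J : ℕ, galoisCohomology (κ.twistModP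
            (W.torsionGaloisModule (p : ℤ)) IwasawaH1Data.torsion_nsmul_eq_zero J) 1) (p ^ n) →
          ∃ ψ' : contOneCocycles (κ.twistModP (W.torsionGaloisModule (p : ℤ))
              IwasawaH1Data.torsion_nsmul_eq_zero (p ^ n)).toTopRep,
            (∀ g, ψ'.1 g = (shiftEnd (WeierstrassCurve.geomTorsion W (p : ℤ)) (p ^ n) ^ (2 * p ^ m) * V)
              (φ.1 g)) ∧
            cores (κ.twistModP (W.torsionGaloisModule (p : ℤ)) IwasawaH1Data.torsion_nsmul_eq_zero
                (p ^ n)).toTopRep (rootsOfUnityFixer ℚ ((primesEquiv q : Nat.Primes) : ℕ))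
              (isOpen_rootsOfUnityFixer ℚ _) (oneCocycleClass _ y') = oneCocycleClass _ ψ' := by
  classical
  obtain ⟨S₀, hS₀, hmain⟩ := exists_tameClass_of_isEulerSystemClass W p κ γ I hES
  -- enlarge `S₀` by the bad places and the places of `p` (x9 p455730)
  obtain ⟨S₁, hS₁, hsub, hgood⟩ :=
    TorsionUnramified.exists_finite_superset_isUnramifiedAt_torsionGaloisModule W (K := ℚ)
      (p := p) (Fact.out : p.Prime).ne_zero hS₀
  refine ⟨S₁, hS₁, ?_⟩
  intro q hq1 𝔓 h𝔓 Fr hFr hsplit m hFrm hFrm' n _ _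
  have hq0 : q ∉ S₀ := fun h ↦ hq1 (hsub h)
  obtain ⟨hqp, hqgood, -⟩ := hgood q hq1
  have hne : ((primesEquiv q : Nat.Primes) : ℕ) ≠ p := primesEquiv_ne_of_natCast_not_mem hqp
  have hFr' : IsArithFrobAtPlace ℚ q Fr := ⟨𝔓, h𝔓, hFr⟩
  -- the `E`-split Euler factor modulo `p` is `(1 - X)²` (lur-a (B))
  have hPz : ((1 - X) ^ 2 : ℤ[X]).map (Int.castRingHom (ZMod p)) =
      (rubinEulerFactor (tateRep W p).toRepresentation (cyclotomicCharacterToUnits ℚ p ℤ_[p]) Fr).map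
        (PadicInt.toZMod (p := p)) :=
    (EulerFactorModP.map_toZMod_rubinEulerFactor_eq_of_galoisRepTorsion_eq_one W p hne hqgood hFr'
      hsplit).symm
  -- a representative `a = p^m·u` of `κ̄_n(Fr)` (koly (F5) depth lemma)
  obtain ⟨u, hu, ha⟩ := LocalSplitPrime.twistExponent_eq_prime_pow_mul_of_depth κ
    (J := max n (m + 1)) (le_max_right _ _) hFrm hFrm'
  have ha' : ((p ^ m * u : ℕ) : ZMod (p ^ n)) = κ.layerIndex n Fr := by
    rw [← ha]
    exact κ.natCast_twistExponent n _ (le_max_left _ _) Fr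
  -- the generic tame class
  obtain ⟨y, hyint, hynorm⟩ := hmain q hq0 n Fr hFr' ((1 - X) ^ 2) hPz (p ^ m * u) ha'
    (isOpen_rootsOfUnityFixer ℚ _)
  obtain ⟨y', rfl⟩ := oneCocycleClass_surjective _ y
  -- the operator `(1 - (1+S)^{p^m u})² = S^{2p^m}·V` (lur-a (C) = koly (F5) squared)
  obtain ⟨V, hV, hSV, hVeq⟩ := EulerFactorModP.exists_aeval_unipotentPow_eq_shiftEnd_pow_mul_unit
    (J := p ^ n) p IwasawaH1Data.torsion_nsmul_eq_zero m u hu (Pbar := (1 - X) ^ 2) rfl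
  refine ⟨y', V, fun w hw 𝔓' h𝔓' ↦ ?_, hV, hSV, fun φ hφ ↦ ?_⟩
  · exact (mem_integralH1_iff _ p _ _).1 hyint w (primesEquiv_ne_of_natCast_not_mem hw) 𝔓' h𝔓'
  · obtain ⟨ψ, hψ, hclass⟩ := hynorm φ hφ
    refine ⟨ψ, fun g ↦ ?_, hclass⟩
    rw [hψ g, hVeq]

end Summit.BirchSwinnertonDyer.BirchSwinnertonDyer.Rank1Residual.TameClass

end
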